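import Summits.KontsevichZagierPeriods.KontsevichZagierPeriods.Theses.LinRedNormalForm
import Literature.NumberTheory.Transcendental.MultipleZetaValuesHoffmanProofs

/-!
# Crux `HoffmanIndependence` (stmt-KontsevichZagierPeriods-15045) — negative lemmas:
# the alphabet `{2,3}` is load-bearing, and the family is maximal through weight 9

Disprover output (cdisprove cycle 1; workfile `Cruxes/HoffmanIndependence/Disproof.lean`, §A–§B).
The crux `LinearIndependent ℚ (fun u : {u // IsHoffman u} => multipleZeta u.1)` has no hypothesis
to drop; its only datum is the index set `{2,3}^×`. Every mutation of that alphabet tried is FALSE,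
by relations that are theorems of the tree:

* `hoffmanIndependence_false_without_noOnes` — `IsHoffman ↦ IsAdmissible`: `ζ(2,1) = ζ(3)` (Euler);
* `hoffmanIndependence_false_without_noLargeLetters` — `{2,3} ↦` "entries `≥ 2`": `4ζ(2,2) = 3ζ(4)`;
* `hoffmanIndependence_false_letterFour` — `{2,3} ↦ {2,4}`: the same witness;
* `hoffmanIndependence_false_mirrorAlphabet` — `{2,3} ↦` admissible `{1,2}`-words: `3ζ(2,1,1) = 4ζ(2,2)`;

and the family cannot be ENLARGED either:

* `hoffmanIndependence_tight_insert` — for every admissible non-Hoffman `s` of weight `≤ 9`,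
  `{2,3}^× ∪ {s}` is dependent (`ζ(s) ∈ hoffmanSpan`, Brown's theorem, unconditional in the tree in
  weights `≤ 9`): the crux asserts a basis, not merely an independent set.

None of these touches the crux itself (open, Zagier-conjecture strength); they delimit it for the
provers and planners: any argument must use "no letter 1" AND "no letter ≥ 4", and cannot come from a
statement that is insensitive to the alphabet.
-/

namespace Summit.KontsevichZagierPeriods.HoffmanIndependence.Negative

open Literature.NumberTheory.Transcendental MZV

/-- **Relaxing `{2,3}` to all admissible indices is false**: Euler's `ζ(2,1) = ζ(3)` makes the
family non-injective, hence dependent. [folklore] -/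
theorem hoffmanIndependence_false_without_noOnes :
    ¬ LinearIndependent ℚ (fun u : {u : List ℕ // IsAdmissible u} => multipleZeta u.1) := by
  intro h
  have h21 : multipleZeta [2, 1] = multipleZeta [3] := euler_zeta_two_one_holds
  have hinj := h.injective
  have key := @hinj ⟨[2, 1], by decide⟩ ⟨[3], by decide⟩ (by simpa using h21)
  simp at key

/-- **Relaxing `{2,3}` to "all entries `≥ 2`" is false**: `4ζ(2,2) - 3ζ(4) = 0`
(`ζ(2,2) = π⁴/120`, `ζ(4) = π⁴/90`). [folklore] -/
theorem hoffmanIndependence_false_without_noLargeLetters :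
    ¬ LinearIndependent ℚ (fun u : {u : List ℕ // ∀ i ∈ u, 2 ≤ i} => multipleZeta u.1) := by
  intro h
  rw [linearIndependent_iff'] at h
  let a : {u : List ℕ // ∀ i ∈ u, 2 ≤ i} := ⟨[2, 2], by decide⟩
  let b : {u : List ℕ // ∀ i ∈ u, 2 ≤ i} := ⟨[4], by decide⟩
  have hab : a ≠ b := by simp [a, b]
  have key := h {a, b} (fun u => if u = a then 4 else -3) ?_ a (by simp)
  · simp at key
  · rw [Finset.sum_pair hab, if_pos rfl, if_neg hab.symm]
    simp only [a, b, multipleZeta_two_two, multipleZeta_four, Rat.smul_def]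
    push_cast
    ring

/-- **Trading the letter `3` for `4` is false**: the `{2,4}`-family contains `ζ(2,2)` and `ζ(4)`,
and `4ζ(2,2) = 3ζ(4)`. [folklore] -/
theorem hoffmanIndependence_false_letterFour :
    ¬ LinearIndependent ℚ (fun u : {u : List ℕ // ∀ i ∈ u, i = 2 ∨ i = 4} => multipleZeta u.1) := by
  intro h
  rw [linearIndependent_iff'] at h
  let a : {u : List ℕ // ∀ i ∈ u, i = 2 ∨ i = 4} := ⟨[2, 2], by decide⟩
  let b : {u : List ℕ // ∀ i ∈ u, i = 2 ∨ i = 4} := ⟨[4], by decide⟩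
  have hab : a ≠ b := by simp [a, b]
  have key := h {a, b} (fun u => if u = a then 4 else -3) ?_ a (by simp)
  · simp at key
  · rw [Finset.sum_pair hab, if_pos rfl, if_neg hab.symm]
    simp only [a, b, multipleZeta_two_two, multipleZeta_four, Rat.smul_def]
    push_cast
    ring

/-- **The mirror alphabet is false**: among the admissible `{1,2}`-words, `3ζ(2,1,1) = 4ζ(2,2)`
(`ζ(2,1,1) = ζ(4) = π⁴/90`; `(2,1,1)` is the dual of `(4)`, not of a Hoffman word). [folklore] -/
theorem hoffmanIndependence_false_mirrorAlphabet :
    ¬ LinearIndependent ℚ (fun u : {u : List ℕ // IsAdmissible u ∧ ∀ i ∈ u, i = 1 ∨ i = 2} =>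
      multipleZeta u.1) := by
  intro h
  rw [linearIndependent_iff'] at h
  let a : {u : List ℕ // IsAdmissible u ∧ ∀ i ∈ u, i = 1 ∨ i = 2} := ⟨[2, 1, 1], by decide⟩
  let b : {u : List ℕ // IsAdmissible u ∧ ∀ i ∈ u, i = 1 ∨ i = 2} := ⟨[2, 2], by decide⟩
  have hab : a ≠ b := by simp [a, b]
  have key := h {a, b} (fun u => if u = a then 3 else -4) ?_ a (by simp)
  · simp at key
  · rw [Finset.sum_pair hab, if_pos rfl, if_neg hab.symm]
    simp only [a, b, multipleZeta_two_two, multipleZeta_two_one_one, Rat.smul_def]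
    push_cast
    ring

/-- **Tightness through weight 9**: for an admissible NON-Hoffman index `s` of weight `≤ 9`, the
enlarged family `{2,3}^× ∪ {s}` is `ℚ`-linearly dependent, since `ζ(s)` lies in the Hoffman span of
its weight (`multipleZeta_mem_hoffmanSpan_of_weight_le_nine`, Brown's theorem, unconditional there).
So `HoffmanIndependence` asserts a BASIS of the MZV space, weight by weight.
[cite: Brown2012, Theorem 1.1] -/
theorem hoffmanIndependence_tight_insert {s : List ℕ} (hs : IsAdmissible s)
    (hns : ¬ IsHoffman s) (hw : weight s ≤ 9) :
    ¬ LinearIndependent ℚ (fun u : {u : List ℕ // IsHoffman u ∨ u = s} => multipleZeta u.1) := by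
  intro h
  set i₀ : {u : List ℕ // IsHoffman u ∨ u = s} := ⟨s, Or.inr rfl⟩ with hi₀
  have hnot : i₀ ∉ {u : {u : List ℕ // IsHoffman u ∨ u = s} | u ≠ i₀} := by simp
  apply h.notMem_span_image hnot
  have hmem : multipleZeta s ∈ hoffmanSpan (weight s) :=
    multipleZeta_mem_hoffmanSpan_of_weight_le_nine hs hw
  unfold hoffmanSpan at hmem
  refine Submodule.span_mono ?_ hmem
  rintro x ⟨t, ht, -, rfl⟩
  refine ⟨⟨t, Or.inl ht⟩, ?_, rfl⟩
  intro e
  have hts : t = s :=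
    congrArg Subtype.val (show (⟨t, Or.inl ht⟩ : {u : List ℕ // IsHoffman u ∨ u = s}) = i₀ from e)
  exact hns (hts ▸ ht)

end Summit.KontsevichZagierPeriods.HoffmanIndependence.Negative
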